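import Literature.MathematicalPhysics.QuantumFieldTheory.YangMillsOS
import Literature.MathematicalPhysics.QuantumLattice.GaugeGroups
import Literature.MathematicalPhysics.QuantumLattice.GrassmannIntegral
import Literature.MathematicalPhysics.QuantumLattice.AbelianFieldTensor
import Literature.Probability.LatticeModels.LatticeGreenFunction
import HarnessLib

/-!
# `SelfNormalisedSkewness` (W₂ of route `ScalingWindowSplit`) — negative side: witness DATA

Definitions (only) of the objects of the `U(1)` super-weak-coupling witness against the crux
`stmt-QuantumFields-18944` (line `Sketch`, negation branch), shared by the lead's assembly files:

* `u1LatticeRep` — `U(1) = Circle` with its defining `1 × 1` unitary representation `u1Rep`, as a `LatticeRep`;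
* `swScheme s` — the super-weak scaling scheme `a_k = 1/(k+1)`, `L_k = (k+1)²`, `β_k = (k+1)^s`
  (bare renormalisation `c ≡ 1`, `m ≡ 0`; the crux re-renormalises by itself);
* `plaqCoboundary S` — the real plaquette coboundary `d` of the discrete torus `(ℤ/S)⁴` as a linear map
  `(Edge 4 S → ℝ) →ₗ[ℝ] ℝ^{Plaquette 4 S}` (Euclidean target, so that `LinearMap.range` carries the inner product of
  the lattice-Maxwell Gaussian), `plaqIncidence` its integer matrix;
* `plaqAngle U` — Lüscher's plaquette angles `arg U_p ∈ (-π, π]` of a `U(1)` torus configuration, as a vector of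
  `ℝ^{Plaquette 4 S}` (`abelianFieldTensor` re-indexed);
* `greenHess` — the mixed second difference `∇ᵢ⁺∇ⱼ⁻ G̃_L` of the zero-mode-free torus Green function
  (`torusGreen`), the lattice `F`-propagator up to the map `K` of `TreeLevelSkewnessVanishes`.

References: Wilson 1974; Lüscher, Nucl. Phys. B 549 (1999) (abelian field tensor); Glimm–Jaffe 1987 §6.1.
-/

noncomputable section

open scoped BigOperators
open Filter Topology
open Literature.MathematicalPhysics.QuantumLattice Literature.MathematicalPhysics.AQFT
  Literature.MathematicalPhysics.QuantumFieldTheory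
open Literature.Probability.LatticeModels (TorusSite torusGreen)

namespace Summit.QuantumFields.YangMills.Theorems.SelfNormalisedSkewness.Negative

/-- **`U(1)` as lattice-representation data**: `Circle` with its defining one-dimensional unitary
representation `u1Rep` (continuous, faithful, unitary — all in the tree). [folklore] -/
def u1LatticeRep : LatticeRep Circle :=
  ⟨1, u1Rep, continuous_u1Rep, u1Rep_injective, u1Rep_mem_unitaryGroup⟩

/-- `u1LatticeRep.ρ = u1Rep`. [folklore] -/
@[simp] theorem u1LatticeRep_ρ : u1LatticeRep.ρ = u1Rep := rfl

/-- `u1LatticeRep.N = 1`. [folklore] -/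
@[simp] theorem u1LatticeRep_N : u1LatticeRep.N = 1 := rfl

/-- **The super-weak scaling scheme** `a_k = 1/(k+1)`, `β_k = (k+1)^s`, `L_k = (k+1)²` (so `a_k L_k = k+1 → ∞`,
`a_k⁻¹ ≤ a_k L_k`: polynomial volumes with `N = 1`), bare renormalisation `c ≡ 1`, `m ≡ 0`. [folklore] -/
def swScheme (s : ℕ) : SpeciesScheme (YMSpecies Circle) where
  a := fun k => ((k : ℝ) + 1)⁻¹
  a_pos := fun k => by positivity
  tendsto_a := tendsto_inv_atTop_zero.comp (tendsto_natCast_atTop_atTop.atTop_add tendsto_const_nhds)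
  β := fun k => ((k : ℝ) + 1) ^ s
  L := fun k => (k + 1) ^ 2
  tendsto_L := by
    have h : (fun k : ℕ => ((k : ℝ) + 1)⁻¹ * (((k + 1) ^ 2 : ℕ) : ℝ)) = fun k : ℕ => (k : ℝ) + 1 := by
      funext k; push_cast; field_simp
    rw [h]
    exact tendsto_natCast_atTop_atTop.atTop_add tendsto_const_nhds
  c := fun _ _ => 1
  m := fun _ _ => 0

/-- `(swScheme s).a k = (k+1)⁻¹`. [folklore] -/
@[simp] theorem swScheme_a (s k : ℕ) : (swScheme s).a k = ((k : ℝ) + 1)⁻¹ := rfl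

/-- `(swScheme s).β k = (k+1)^s`. [folklore] -/
@[simp] theorem swScheme_β (s k : ℕ) : (swScheme s).β k = ((k : ℝ) + 1) ^ s := rfl

/-- `(swScheme s).L k = (k+1)²`. [folklore] -/
@[simp] theorem swScheme_L (s k : ℕ) : (swScheme s).L k = (k + 1) ^ 2 := rfl

/-- `(swScheme s).c ≡ 1`. [folklore] -/
@[simp] theorem swScheme_c (s : ℕ) (σ : YMSpecies Circle) (k : ℕ) : (swScheme s).c σ k = 1 := rfl

/-- `(swScheme s).m ≡ 0`. [folklore] -/
@[simp] theorem swScheme_m (s : ℕ) (σ : YMSpecies Circle) (k : ℕ) : (swScheme s).m σ k = 0 := rfl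

/-- The torus side of `swScheme`: `2(k+1)² + 1`. [folklore] -/
theorem swScheme_side (s k : ℕ) : (swScheme s).side k = 2 * (k + 1) ^ 2 + 1 := rfl

/-- **The integer incidence matrix of the plaquette coboundary** of `(ℤ/S)⁴`: the coefficient of the link
`(y, τ)` in `(dθ)(x; μ<ν) = θ(x,μ) + θ(x+e_μ,ν) - θ(x+e_ν,μ) - θ(x,ν)`. [folklore] -/
def plaqIncidence (S : ℕ) (p : Plaquette 4 S) (e : Edge 4 S) : ℤ :=
  (if e = (p.1, p.2.1.1) then 1 else 0) + (if e = (p.1 + Pi.single p.2.1.1 1, p.2.1.2) then 1 else 0) -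
    (if e = (p.1 + Pi.single p.2.1.2 1, p.2.1.1) then 1 else 0) - (if e = (p.1, p.2.1.2) then 1 else 0)

/-- **The real plaquette coboundary** `d : ℝ^{Edge 4 S} → ℝ^{Plaquette 4 S}`,
`(dθ)(x; μ<ν) = θ(x,μ) + θ(x+e_μ,ν) - θ(x+e_ν,μ) - θ(x,ν)`, with Euclidean target. [folklore] -/
def plaqCoboundary (S : ℕ) : (Edge 4 S → ℝ) →ₗ[ℝ] EuclideanSpace ℝ (Plaquette 4 S) where
  toFun θ := WithLp.toLp 2 fun p : Plaquette 4 S =>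
    θ (p.1, p.2.1.1) + θ (p.1 + Pi.single p.2.1.1 1, p.2.1.2) - θ (p.1 + Pi.single p.2.1.2 1, p.2.1.1) -
      θ (p.1, p.2.1.2)
  map_add' θ θ' := by ext p; simp only [Pi.add_apply, PiLp.add_apply]; ring
  map_smul' c θ := by ext p; simp only [Pi.smul_apply, smul_eq_mul, RingHom.id_apply, PiLp.smul_apply]; ring

/-- `plaqCoboundary` unfolded. [folklore] -/
@[simp] theorem plaqCoboundary_apply (S : ℕ) (θ : Edge 4 S → ℝ) (x : Site 4 S)
    (q : {q : Fin 4 × Fin 4 // q.1 < q.2}) :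
    plaqCoboundary S θ (x, q) = θ (x, q.1.1) + θ (x + Pi.single q.1.1 1, q.1.2) -
      θ (x + Pi.single q.1.2 1, q.1.1) - θ (x, q.1.2) := rfl

/-- `plaqCoboundary` has the integer matrix `plaqIncidence`. [folklore] -/
theorem plaqCoboundary_eq_sum (S : ℕ) [NeZero S] (θ : Edge 4 S → ℝ) (p : Plaquette 4 S) :
    plaqCoboundary S θ p = ∑ e, (plaqIncidence S p e : ℝ) * θ e := by
  obtain ⟨x, q⟩ := p
  simp only [plaqCoboundary_apply, plaqIncidence, Int.cast_sub, Int.cast_add, Int.cast_ite, Int.cast_one,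
    Int.cast_zero, sub_mul, add_mul, ite_mul, one_mul, zero_mul, Finset.sum_sub_distrib,
    Finset.sum_add_distrib, Finset.sum_ite_eq', Finset.mem_univ, if_true]

/-- **Plaquette angles** `ω_p(U) = arg U_p ∈ (-π, π]` of a `U(1)` torus configuration (Lüscher's abelian field
tensor, re-indexed by `Plaquette 4 S`), as a vector of `ℝ^{Plaquette 4 S}`. [folklore] -/
def plaqAngle {S : ℕ} (U : GaugeConfig 4 S Circle) : EuclideanSpace ℝ (Plaquette 4 S) :=
  WithLp.toLp 2 fun p => abelianFieldTensor U p.1 p.2.1.1 p.2.1.2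

/-- `plaqAngle` unfolded. [folklore] -/
@[simp] theorem plaqAngle_apply {S : ℕ} (U : GaugeConfig 4 S Circle) (p : Plaquette 4 S) :
    plaqAngle U p = abelianFieldTensor U p.1 p.2.1.1 p.2.1.2 := rfl

/-- **Lattice Hessian of the torus Green function**:
`greenHess z i j = G̃(z+eᵢ) - G̃(z+eᵢ-eⱼ) - G̃(z) + G̃(z-eⱼ) = ∇ᵢ⁺∇ⱼ⁻ G̃_L(z)`, `G̃ = torusGreen`. [folklore] -/
def greenHess {L : ℕ} [NeZero L] (z : TorusSite 4 L) (i j : Fin 4) : ℝ :=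
  torusGreen (z + Pi.single i 1) - torusGreen (z + Pi.single i 1 - Pi.single j 1) -
    torusGreen z + torusGreen (z - Pi.single j 1)

end Summit.QuantumFields.YangMills.Theorems.SelfNormalisedSkewness.Negative

end
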